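import Literature.MathematicalPhysics.QuantumLattice.FermiRG.Salmhofer1998Sec2
import HarnessLib

/-!
# Salmhofer 1998, Lemma 1 (the `L¹–L^∞` bound (4.5) for the bilinear term of the RGE) — PROOF

M. Salmhofer, *Continuous renormalization for fermions and Fermi liquid theory*, Commun. Math. Phys.
**194** (1998) 249–295 = arXiv:cond-mat/9706188 [Salmhofer1998], Lemma 1 (render
`paper:arxiv-cond-mat_9706188` p.14 L63–76, proof L78–116).  This file DISCHARGES the named fact
`Literature.MathematicalPhysics.QuantumLattice.FermiRG.Salmhofer1998.DeterminantNormBound` (licence F-079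
of the gate-hubbard-kl wave, typed by t7 in `Salmhofer1998Sec2.lean`):

`theorem DeterminantNormBound_holds : DeterminantNormBound`.

We follow the printed proof (p.14 L78–116): fix the distinguished argument `X_p`; "without loss of
generality `p ≤ m₁ - i`, so that `X_p` is a component of `X₁` (the other case is similar by the symmetry
of the sum for `Q_{m,r}` in `m₁` and `m₂`)"; bound the determinant by `A_{i-1}(t)` ((4.9)); then
`∫ dV φ(V, X₁) χ(V) ≤ sup_V χ(V) ∫ dV φ(V, X₁)` with `φ(V,X₁) = ∫ dY |G_{m₁r₁}(X₁,Y,V)|` and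
`χ(V) = ∫ dW dZ dX₂ |Ḋ_t(V,W)| |G_{m₂r₂}(W,Z̃,X₂)| ≤ sup_V ∫dW |Ḋ_t(V,W)| · sup_W ∫ dZ dX₂ |G_{m₂r₂}(W,Z̃,X₂)|`
((4.10)–(4.11)).  In Lean both cases are written out (`sliceCore_le_left` / `sliceCore_le_right`); the finite-sum
Fubini steps are realised by INJECTIVITY of the argument builders of (4.3) (`argL`, `argR`, the split
`X ↦ (X₁, X₂)`), which is all the printed manipulation uses.  The `m ≥ 1` guard of the fact (rev. 2 of
the typing) is the `max_{p ∈ ℕ_m}` of the norm (4.4).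

Two points where the Lean statement is slightly more general than the printed setting are handled
explicitly: t7's index predicate `MIndex` does not carry `i ≤ m₁, i ≤ m₂` (there `κ_{m₁m₂i} =
C(m₁,i)C(m₂,i) = 0`, so those terms vanish on both sides — `le_of_kappa_ne_zero`), and for an empty `Γ`
both sides are `0` (every term on the right has the factor `‖G_{m₁r₁}‖ = 0`, `m₁ ≥ 1`).

No new definition of mathematical content (`sliceSum`, `argL`, `argR`, `splitL`, `splitR`, `summand`,
`phiL`, `phiR` are proof devices naming sub-terms of t7's `quadTerm` / of (4.10)), no `sorry`, no new
named fact: net fact debt `-1`.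
-/

noncomputable section

open Finset Matrix

namespace Literature.MathematicalPhysics.QuantumLattice.FermiRG

namespace Salmhofer1998

/-! ### Slices of the `L¹–L^∞` norm (4.4) -/

section Slices

variable {Γ : Type*} [Fintype Γ] [DecidableEq Γ]

/-- The slice sum `Σ_{X : X_p = x} |K(X)|` of the norm (4.4) (before the weight `ε^{m-1}` and the
`max_p sup_x`). [cite: Salmhofer1998, §4.1 (4.4) (p.14 L54–61)] -/
def sliceSum {n : ℕ} (K : (Fin n → Γ) → ℂ) (p : Fin n) (x : Γ) : ℝ :=
  ∑ X ∈ Finset.univ.filter (fun X : Fin n → Γ => X p = x), ‖K X‖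

/-- Slices are nonnegative. [cite: Salmhofer1998, §4.1 (4.4) (p.14 L54–61)] -/
theorem sliceSum_nonneg {n : ℕ} (K : (Fin n → Γ) → ℂ) (p : Fin n) (x : Γ) : 0 ≤ sliceSum K p x :=
  Finset.sum_nonneg fun _ _ => norm_nonneg _

/-- `ε^{m-1} Σ_{X_p = x} |K| ≤ ‖K‖` for every `p, x`. [cite: Salmhofer1998, §4.1 (4.4) (p.14 L54–61)] -/
theorem mul_sliceSum_le_kernelNorm (ε : ℝ) {n : ℕ} (K : (Fin (n + 1) → Γ) → ℂ) (p : Fin (n + 1))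
    (x : Γ) : ε ^ n * sliceSum K p x ≤ kernelNorm ε (n + 1) K := by
  rw [kernelNorm_succ]
  exact le_ciSup_of_le (Finite.bddAbove_range _) p
    (le_ciSup_of_le (Finite.bddAbove_range _) x le_rfl)

/-- `Σ_{X_p = x} |K| ≤ ε^{-(m-1)} ‖K‖`. [cite: Salmhofer1998, §4.1 (4.4) (p.14 L54–61)] -/
theorem sliceSum_le {ε : ℝ} (hε : 0 < ε) {n : ℕ} (K : (Fin (n + 1) → Γ) → ℂ) (p : Fin (n + 1))
    (x : Γ) : sliceSum K p x ≤ (ε ^ n)⁻¹ * kernelNorm ε (n + 1) K := by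
  rw [le_inv_mul_iff₀ (pow_pos hε n)]
  exact mul_sliceSum_le_kernelNorm ε K p x

/-- If every weighted slice is `≤ B` then `‖K‖ ≤ B` (`Γ` nonempty). [cite: Salmhofer1998, §4.1 (4.4) (p.14 L54–61)] -/
theorem kernelNorm_le_of_sliceSum_le [Nonempty Γ] (ε : ℝ) {n : ℕ} (K : (Fin (n + 1) → Γ) → ℂ) {B : ℝ}
    (h : ∀ (p : Fin (n + 1)) (x : Γ), ε ^ n * sliceSum K p x ≤ B) :
    kernelNorm ε (n + 1) K ≤ B := by
  rw [kernelNorm_succ]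
  exact ciSup_le fun p => ciSup_le fun x => h p x

/-- On an empty index set every kernel of positive arity has norm `0`. [folklore] -/
private theorem kernelNorm_of_isEmpty [IsEmpty Γ] (ε : ℝ) {n : ℕ} (K : (Fin (n + 1) → Γ) → ℂ) :
    kernelNorm ε (n + 1) K = 0 := by
  rw [kernelNorm_succ]
  simp

/-- Reindexing inequality: the sum of a nonnegative function over the injective image of `s` inside `t`
is at most the sum over `t`. [folklore] -/
private theorem sum_comp_le_sum_of_injOn {κ ι : Type*} [DecidableEq ι] {s : Finset κ} {t : Finset ι}
    (g : κ → ι) (f : ι → ℝ) (hinj : Set.InjOn g s) (hmaps : ∀ a ∈ s, g a ∈ t)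
    (hf : ∀ b ∈ t, 0 ≤ f b) : ∑ a ∈ s, f (g a) ≤ ∑ b ∈ t, f b := by
  rw [← Finset.sum_image hinj]
  refine Finset.sum_le_sum_of_subset_of_nonneg (fun b hb => ?_) fun b hb _ => hf b hb
  obtain ⟨a, ha, rfl⟩ := Finset.mem_image.mp hb
  exact hmaps a ha

end Slices

/-! ### Book-keeping for the measure `∫ dκ_{mr}` -/

section Kappa

variable {Γ : Type*} [Fintype Γ] [DecidableEq Γ]

/-- The real part of a `κ`-sum of real numbers. [cite: Salmhofer1998, Proposition 2 (p.12 L81–95)] -/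
theorem re_kappaSum_ofReal (mbar : ℕ → ℕ) (m r : ℕ) (B : ℕ → ℕ → ℕ → ℕ → ℕ → ℝ) :
    (kappaSum mbar m r fun r₁ m₁ r₂ m₂ i => (B r₁ m₁ r₂ m₂ i : ℂ)).re =
      ∑ r₁ ∈ Finset.Icc 1 (r - 1), ∑ m₁ ∈ Finset.Icc 1 (mbar r₁),
        ∑ m₂ ∈ Finset.Icc 1 (mbar (r - r₁)), ∑ i ∈ Finset.Icc 1 (m₁ + m₂),
          if MIndex mbar r₁ (r - r₁) m m₁ m₂ i = true then
            (kappa m₁ m₂ i : ℝ) * B r₁ m₁ (r - r₁) m₂ i else 0 := by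
  simp only [kappaSum, Complex.re_sum, apply_ite Complex.re, Complex.zero_re, ← Complex.ofReal_natCast,
    ← Complex.ofReal_mul, Complex.ofReal_re]

/-- `|∫ dκ F| ≤ ∫ dκ |F|` (the weights `κ_{m₁m₂i}` are nonnegative). [cite: Salmhofer1998, Proposition 2 (p.12 L93–95)] -/
theorem norm_kappaSum_le (mbar : ℕ → ℕ) (m r : ℕ) (F : ℕ → ℕ → ℕ → ℕ → ℕ → ℂ) :
    ‖kappaSum mbar m r F‖ ≤
      ∑ r₁ ∈ Finset.Icc 1 (r - 1), ∑ m₁ ∈ Finset.Icc 1 (mbar r₁),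
        ∑ m₂ ∈ Finset.Icc 1 (mbar (r - r₁)), ∑ i ∈ Finset.Icc 1 (m₁ + m₂),
          if MIndex mbar r₁ (r - r₁) m m₁ m₂ i = true then
            (kappa m₁ m₂ i : ℝ) * ‖F r₁ m₁ (r - r₁) m₂ i‖ else 0 := by
  unfold kappaSum
  refine (norm_sum_le _ _).trans (Finset.sum_le_sum fun r₁ _ => ?_)
  refine (norm_sum_le _ _).trans (Finset.sum_le_sum fun m₁ _ => ?_)
  refine (norm_sum_le _ _).trans (Finset.sum_le_sum fun m₂ _ => ?_)
  refine (norm_sum_le _ _).trans (Finset.sum_le_sum fun i _ => ?_)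
  split_ifs
  · rw [norm_mul, Complex.norm_natCast]
  · rw [norm_zero]

/-- What membership in the index set `𝓜` (t7's `MIndex`) says. [cite: Salmhofer1998, Proposition 2 (p.12 L81–95)] -/
theorem MIndex_spec {mbar : ℕ → ℕ} {r₁ r₂ m m₁ m₂ i : ℕ} (h : MIndex mbar r₁ r₂ m m₁ m₂ i = true) :
    1 ≤ i ∧ 1 ≤ m₁ ∧ m₁ ≤ mbar r₁ ∧ 1 ≤ m₂ ∧ m₂ ≤ mbar r₂ ∧ m₁ + m₂ = m + 2 * i ∧
      m₁ % 2 = 0 ∧ m₂ % 2 = 0 := by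
  simpa [MIndex, Bool.and_eq_true, decide_eq_true_eq, and_assoc] using h

/-- `κ_{m₁m₂i} ≠ 0` forces `i ≤ m₁` and `i ≤ m₂`. [cite: Salmhofer1998, Proposition 2 (p.12 L93–94)] -/
theorem le_of_kappa_ne_zero {m₁ m₂ i : ℕ} (h : kappa m₁ m₂ i ≠ 0) : i ≤ m₁ ∧ i ≤ m₂ := by
  unfold kappa at h
  obtain ⟨h1, h2⟩ := mul_ne_zero_iff.mp h
  exact ⟨not_lt.mp fun hlt => h1 (Nat.choose_eq_zero_of_lt hlt),
    not_lt.mp fun hlt => h2 (Nat.choose_eq_zero_of_lt hlt)⟩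

/-- Slices of a `κ`-sum of kernels are bounded by the `κ`-sum of slice bounds; the bound is only needed on
the support of `κ` inside `𝓜`. [cite: Salmhofer1998, Lemma 1 proof (4.9) (p.14 L82–89)] -/
theorem mul_sliceSum_kappaSum_le {n : ℕ} (mbar : ℕ → ℕ) (m r : ℕ)
    (Φ : ℕ → ℕ → ℕ → ℕ → ℕ → (Fin (n + 1) → Γ) → ℂ) (B : ℕ → ℕ → ℕ → ℕ → ℕ → ℝ) {c : ℝ} (hc : 0 ≤ c)
    (p : Fin (n + 1)) (x : Γ)
    (hB : ∀ r₁ m₁ m₂ i, 1 ≤ i → i ≤ m₁ → i ≤ m₂ → m₁ + m₂ = m + 2 * i →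
      c * sliceSum (Φ r₁ m₁ (r - r₁) m₂ i) p x ≤ B r₁ m₁ (r - r₁) m₂ i) :
    c * sliceSum (fun X => kappaSum mbar m r fun r₁ m₁ r₂ m₂ i => Φ r₁ m₁ r₂ m₂ i X) p x ≤
      (kappaSum mbar m r fun r₁ m₁ r₂ m₂ i => (B r₁ m₁ r₂ m₂ i : ℂ)).re := by
  rw [re_kappaSum_ofReal]
  unfold sliceSum
  set S := Finset.univ.filter (fun X : Fin (n + 1) → Γ => X p = x) with hS
  calc c * ∑ X ∈ S, ‖kappaSum mbar m r fun r₁ m₁ r₂ m₂ i => Φ r₁ m₁ r₂ m₂ i X‖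
      ≤ c * ∑ X ∈ S, ∑ r₁ ∈ Finset.Icc 1 (r - 1), ∑ m₁ ∈ Finset.Icc 1 (mbar r₁),
          ∑ m₂ ∈ Finset.Icc 1 (mbar (r - r₁)), ∑ i ∈ Finset.Icc 1 (m₁ + m₂),
            (if MIndex mbar r₁ (r - r₁) m m₁ m₂ i = true then
              (kappa m₁ m₂ i : ℝ) * ‖Φ r₁ m₁ (r - r₁) m₂ i X‖ else 0) :=
        mul_le_mul_of_nonneg_left (Finset.sum_le_sum fun X _ => norm_kappaSum_le mbar m r _) hc
    _ = ∑ r₁ ∈ Finset.Icc 1 (r - 1), ∑ m₁ ∈ Finset.Icc 1 (mbar r₁),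
          ∑ m₂ ∈ Finset.Icc 1 (mbar (r - r₁)), ∑ i ∈ Finset.Icc 1 (m₁ + m₂),
            c * ∑ X ∈ S, (if MIndex mbar r₁ (r - r₁) m m₁ m₂ i = true then
              (kappa m₁ m₂ i : ℝ) * ‖Φ r₁ m₁ (r - r₁) m₂ i X‖ else 0) := by
        rw [Finset.sum_comm, Finset.mul_sum]
        refine Finset.sum_congr rfl fun r₁ _ => ?_
        rw [Finset.sum_comm, Finset.mul_sum]
        refine Finset.sum_congr rfl fun m₁ _ => ?_
        rw [Finset.sum_comm, Finset.mul_sum]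
        refine Finset.sum_congr rfl fun m₂ _ => ?_
        rw [Finset.sum_comm, Finset.mul_sum]
    _ ≤ _ := by
        refine Finset.sum_le_sum fun r₁ _ => Finset.sum_le_sum fun m₁ _ =>
          Finset.sum_le_sum fun m₂ _ => Finset.sum_le_sum fun i _ => ?_
        by_cases hM : MIndex mbar r₁ (r - r₁) m m₁ m₂ i = true
        · simp only [hM, if_true]
          by_cases hκ : kappa m₁ m₂ i = 0
          · simp [hκ]
          have hspec := MIndex_spec hM
          have hle := le_of_kappa_ne_zero hκ
          have h := hB r₁ m₁ m₂ i hspec.1 hle.1 hle.2 hspec.2.2.2.2.2.1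
          unfold sliceSum at h
          rw [← hS] at h
          calc c * ∑ X ∈ S, (kappa m₁ m₂ i : ℝ) * ‖Φ r₁ m₁ (r - r₁) m₂ i X‖
              = (kappa m₁ m₂ i : ℝ) * (c * ∑ X ∈ S, ‖Φ r₁ m₁ (r - r₁) m₂ i X‖) := by
                rw [← Finset.mul_sum]; ring
            _ ≤ (kappa m₁ m₂ i : ℝ) * B r₁ m₁ (r - r₁) m₂ i :=
                mul_le_mul_of_nonneg_left h (Nat.cast_nonneg _)
        · simp [hM]

end Kappa

/-! ### The argument builders of (4.3) and their injectivity -/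

section Builders

variable {Γ : Type*}

/-- The argument `(X₁, Y, V)` of `G_{m₁r₁}` in (4.3): `X₁ = (X_1,…,X_{m₁-i})`, then `Y ∈ Γ^{i-1}`, then
`V` (this is the lambda-term inside `quadTerm`, with `X₁` as a separate variable).
[cite: Salmhofer1998, (4.3) (p.14 L44–52)] -/
def argL (m₁ i : ℕ) (X₁ : Fin (m₁ - i) → Γ) (Y : Fin (i - 1) → Γ) (V : Γ) : Fin m₁ → Γ :=
  fun j => if hj : j.val < m₁ - i then X₁ ⟨j.val, hj⟩
    else if hj' : j.val - (m₁ - i) < i - 1 then Y ⟨j.val - (m₁ - i), hj'⟩ else V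

/-- The argument `(W, Z̃, X₂)` of `G_{m₂r₂}` in (4.3): `W`, then `Z` reversed, then
`X₂ = (X_{m₁-i+1},…,X_m)`. [cite: Salmhofer1998, (4.3) (p.14 L44–52)] -/
def argR (m₂ i : ℕ) (W : Γ) (Z : Fin (i - 1) → Γ) (X₂ : Fin (m₂ - i) → Γ) : Fin m₂ → Γ :=
  fun j => if hj : j.val = 0 then W
    else if hj' : j.val - 1 < i - 1 then Z ⟨(i - 2) - (j.val - 1), by omega⟩
    else X₂ ⟨j.val - i, by omega⟩

/-- The left part `X₁ = (X_1,…,X_{m₁-i})` of `X ∈ Γ^m`, `m = (m₁-i)+(m₂-i)`.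
[cite: Salmhofer1998, Proposition 2 (p.12 L99–100)] -/
def splitL {m m₁ m₂ i : ℕ} (h : (m₁ - i) + (m₂ - i) = m) (X : Fin m → Γ) : Fin (m₁ - i) → Γ :=
  fun q => X ⟨q.val, by omega⟩

/-- The right part `X₂ = (X_{m₁-i+1},…,X_m)` of `X ∈ Γ^m`, `m = (m₁-i)+(m₂-i)`.
[cite: Salmhofer1998, Proposition 2 (p.12 L99–100)] -/
def splitR {m m₁ m₂ i : ℕ} (h : (m₁ - i) + (m₂ - i) = m) (X : Fin m → Γ) : Fin (m₂ - i) → Γ :=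
  fun q => X ⟨(m₁ - i) + q.val, by omega⟩

variable {m₁ m₂ i : ℕ}

/-- The first `m₁ - i` legs of `argL` are `X₁`. [cite: Salmhofer1998, (4.3) (p.14 L44–52)] -/
theorem argL_apply_lt (X₁ : Fin (m₁ - i) → Γ) (Y : Fin (i - 1) → Γ) (V : Γ) (q : Fin (m₁ - i)) :
    argL m₁ i X₁ Y V ⟨q.val, by omega⟩ = X₁ q := by
  simp [argL, q.isLt]

/-- The middle `i - 1` legs of `argL` are `Y`. [cite: Salmhofer1998, (4.3) (p.14 L44–52)] -/
theorem argL_apply_mid (hi : 1 ≤ i) (him : i ≤ m₁) (X₁ : Fin (m₁ - i) → Γ) (Y : Fin (i - 1) → Γ)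
    (V : Γ) (q : Fin (i - 1)) :
    argL m₁ i X₁ Y V ⟨(m₁ - i) + q.val, by omega⟩ = Y q := by
  have h1 : ¬ ((m₁ - i) + q.val < m₁ - i) := by omega
  have h2 : (m₁ - i) + q.val - (m₁ - i) < i - 1 := by have := q.isLt; omega
  simp only [argL, h1, dif_neg, not_false_eq_true, h2, dif_pos]
  congr 1
  ext
  simp

/-- The last leg of `argL` is `V`. [cite: Salmhofer1998, (4.3) (p.14 L44–52)] -/
theorem argL_apply_last (hi : 1 ≤ i) (him : i ≤ m₁) (X₁ : Fin (m₁ - i) → Γ) (Y : Fin (i - 1) → Γ)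
    (V : Γ) : argL m₁ i X₁ Y V ⟨m₁ - 1, by omega⟩ = V := by
  have h1 : ¬ (m₁ - 1 < m₁ - i) := by omega
  have h2 : ¬ (m₁ - 1 - (m₁ - i) < i - 1) := by omega
  simp only [argL, h1, dif_neg, not_false_eq_true, h2]

/-- The first leg of `argR` is `W`. [cite: Salmhofer1998, (4.3) (p.14 L44–52)] -/
theorem argR_apply_zero (hm : 1 ≤ m₂) (W : Γ) (Z : Fin (i - 1) → Γ) (X₂ : Fin (m₂ - i) → Γ) :
    argR m₂ i W Z X₂ ⟨0, by omega⟩ = W := by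
  simp [argR]

/-- Legs `2, …, i` of `argR` are `Z` reversed (`Z̃`). [cite: Salmhofer1998, (4.3) (p.14 L44–52)] -/
theorem argR_apply_mid (hi : 1 ≤ i) (him : i ≤ m₂) (W : Γ) (Z : Fin (i - 1) → Γ)
    (X₂ : Fin (m₂ - i) → Γ) (q : Fin (i - 1)) :
    argR m₂ i W Z X₂ ⟨i - 1 - q.val, by have := q.isLt; omega⟩ = Z q := by
  have hq := q.isLt
  have h1 : ¬ (i - 1 - q.val = 0) := by omega
  have h2 : i - 1 - q.val - 1 < i - 1 := by omega
  simp only [argR, h1, dif_neg, not_false_eq_true, h2, dif_pos]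
  congr 1
  ext
  simp only
  omega

/-- The last `m₂ - i` legs of `argR` are `X₂`. [cite: Salmhofer1998, (4.3) (p.14 L44–52)] -/
theorem argR_apply_ge (hi : 1 ≤ i) (him : i ≤ m₂) (W : Γ) (Z : Fin (i - 1) → Γ)
    (X₂ : Fin (m₂ - i) → Γ) (q : Fin (m₂ - i)) :
    argR m₂ i W Z X₂ ⟨i + q.val, by have := q.isLt; omega⟩ = X₂ q := by
  have hq := q.isLt
  have h1 : ¬ (i + q.val = 0) := by omega
  have h2 : ¬ (i + q.val - 1 < i - 1) := by omega
  simp only [argR, h1, dif_neg, not_false_eq_true, h2]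
  congr 1
  ext
  simp

/-- `argL` is injective in `(X₁, Y, V)` (for `1 ≤ i ≤ m₁`). [cite: Salmhofer1998, (4.3) (p.14 L44–52)] -/
theorem argL_injective (hi : 1 ≤ i) (him : i ≤ m₁) {X₁ X₁' : Fin (m₁ - i) → Γ}
    {Y Y' : Fin (i - 1) → Γ} {V V' : Γ} (h : argL m₁ i X₁ Y V = argL m₁ i X₁' Y' V') :
    X₁ = X₁' ∧ Y = Y' ∧ V = V' := by
  refine ⟨?_, ?_, ?_⟩
  · funext q
    rw [← argL_apply_lt X₁ Y V q, ← argL_apply_lt X₁' Y' V' q, h]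
  · funext q
    rw [← argL_apply_mid hi him X₁ Y V q, ← argL_apply_mid hi him X₁' Y' V' q, h]
  · rw [← argL_apply_last hi him X₁ Y V, ← argL_apply_last hi him X₁' Y' V', h]

/-- `argR` is injective in `(W, Z, X₂)` (for `1 ≤ i ≤ m₂`). [cite: Salmhofer1998, (4.3) (p.14 L44–52)] -/
theorem argR_injective (hi : 1 ≤ i) (him : i ≤ m₂) {W W' : Γ} {Z Z' : Fin (i - 1) → Γ}
    {X₂ X₂' : Fin (m₂ - i) → Γ} (h : argR m₂ i W Z X₂ = argR m₂ i W' Z' X₂') :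
    W = W' ∧ Z = Z' ∧ X₂ = X₂' := by
  have hm : 1 ≤ m₂ := le_trans hi him
  refine ⟨?_, ?_, ?_⟩
  · rw [← argR_apply_zero hm W Z X₂, ← argR_apply_zero hm W' Z' X₂', h]
  · funext q
    rw [← argR_apply_mid hi him W Z X₂ q, ← argR_apply_mid hi him W' Z' X₂' q, h]
  · funext q
    rw [← argR_apply_ge hi him W Z X₂ q, ← argR_apply_ge hi him W' Z' X₂' q, h]

/-- `X ↦ (X₁, X₂)` is injective. [cite: Salmhofer1998, Proposition 2 (p.12 L99–100)] -/
theorem split_injective {m : ℕ} (h : (m₁ - i) + (m₂ - i) = m) {X X' : Fin m → Γ}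
    (hL : splitL h X = splitL h X') (hR : splitR h X = splitR h X') : X = X' := by
  funext j
  by_cases hj : j.val < m₁ - i
  · have := congrFun hL ⟨j.val, hj⟩
    simpa [splitL] using this
  · have hj' : j.val - (m₁ - i) < m₂ - i := by have := j.isLt; omega
    have := congrFun hR ⟨j.val - (m₁ - i), hj'⟩
    simp only [splitR] at this
    have e : (⟨(m₁ - i) + (j.val - (m₁ - i)), by omega⟩ : Fin m) = j := by
      ext; simp only; omega
    rwa [e] at this

end Builders

/-! ### The summand of (4.3) for one index `(r₁, m₁, r₂, m₂, i)` and its pointwise bound -/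

section Summand

variable {Γ : Type*} [Fintype Γ]

/-- `|∫_{Γ^n} dX F(X)| ≤ ε^n Σ_X |F(X)|`. [cite: Salmhofer1998, §3 (p.11 L8–13)] -/
theorem norm_gInt_le {ε : ℝ} (hε : 0 ≤ ε) {n : ℕ} (F : (Fin n → Γ) → ℂ) :
    ‖gInt ε F‖ ≤ ε ^ n * ∑ X, ‖F X‖ := by
  unfold gInt
  rw [norm_mul, Complex.norm_real, Real.norm_of_nonneg (pow_nonneg hε n)]
  exact mul_le_mul_of_nonneg_left (norm_sum_le _ _) (pow_nonneg hε n)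

variable (ε : ℝ) (D Ddot : ℝ → Γ → Γ → ℂ) (G₁ G₂ : KernelFamily Γ) (t : ℝ)

/-- The `(r₁,m₁,r₂,m₂,i)` summand of `Q_{m,r}(t | X)` in the form (4.3), with the arguments of
`G_{m₁r₁}`, `G_{m₂r₂}` written through `argL`/`argR`/`splitL`/`splitR` (definitionally the term inside
t7's `quadTerm`). [cite: Salmhofer1998, (4.3) (p.14 L44–52)] -/
def summand (r₁ m₁ r₂ m₂ i m : ℕ) (X : Fin m → Γ) : ℂ :=
  if h : i ≤ m₁ ∧ i ≤ m₂ ∧ m₁ + m₂ = m + 2 * i then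
    ((i : ℂ) ^ 2) *
      gInt ε (fun VW : Fin 2 → Γ =>
        Ddot t (VW 0) (VW 1) *
          gInt ε (fun Y : Fin (i - 1) → Γ =>
            gInt ε (fun Z : Fin (i - 1) → Γ =>
              (covMatrix (D t) Y Z).det *
                G₁ m₁ r₁ t (argL m₁ i (splitL (show (m₁ - i) + (m₂ - i) = m by omega) X) Y (VW 0)) *
                G₂ m₂ r₂ t (argR m₂ i (VW 1) Z (splitR (show (m₁ - i) + (m₂ - i) = m by omega) X)))))
  else 0

/-- `quadTerm` is the `κ`-sum of `summand` (definitional). [cite: Salmhofer1998, (4.3) (p.14 L44–52)] -/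
theorem quadTerm_eq_kappaSum_summand (mbar : ℕ → ℕ) (m r : ℕ) (X : Fin m → Γ) :
    quadTerm ε mbar D Ddot G₁ G₂ m r t X =
      kappaSum mbar m r (fun r₁ m₁ r₂ m₂ i => summand ε D Ddot G₁ G₂ t r₁ m₁ r₂ m₂ i m X) := rfl

variable {ε D Ddot G₁ G₂ t}

/-- The pointwise bound (4.9)–(4.10): `|summand(X)| ≤ i² A_{i-1} ε^{2i} Σ_{V,W} |Ḋ(V,W)| (Σ_Y |G₁(X₁,Y,V)|)(Σ_Z |G₂(W,Z̃,X₂)|)`.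
[cite: Salmhofer1998, Lemma 1 proof (4.9)–(4.10) (p.14 L82–104)] -/
theorem norm_summand_le (hε : 0 < ε) {A : ℕ → ℝ → ℝ}
    (hA : ∀ (i : ℕ) (Y Z : Fin i → Γ), ‖(covMatrix (D t) Y Z).det‖ ≤ A i t)
    (r₁ m₁ r₂ m₂ i m : ℕ) (h : i ≤ m₁ ∧ i ≤ m₂ ∧ m₁ + m₂ = m + 2 * i) (X : Fin m → Γ) :
    ‖summand ε D Ddot G₁ G₂ t r₁ m₁ r₂ m₂ i m X‖ ≤
      (i : ℝ) ^ 2 * A (i - 1) t * (ε ^ 2 * (ε ^ (i - 1) * ε ^ (i - 1))) *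
        ∑ VW : Fin 2 → Γ, ‖Ddot t (VW 0) (VW 1)‖ *
          ((∑ Y : Fin (i - 1) → Γ,
              ‖G₁ m₁ r₁ t (argL m₁ i (splitL (show (m₁ - i) + (m₂ - i) = m by omega) X) Y (VW 0))‖) *
            ∑ Z : Fin (i - 1) → Γ,
              ‖G₂ m₂ r₂ t (argR m₂ i (VW 1) Z (splitR (show (m₁ - i) + (m₂ - i) = m by omega) X))‖) := by
  have hε' := hε.le
  set hs : (m₁ - i) + (m₂ - i) = m := (by omega) with hs_def
  set a : (Fin (i - 1) → Γ) → Γ → ℝ :=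
    fun Y V => ‖G₁ m₁ r₁ t (argL m₁ i (splitL hs X) Y V)‖ with ha
  set b : Γ → (Fin (i - 1) → Γ) → ℝ :=
    fun W Z => ‖G₂ m₂ r₂ t (argR m₂ i W Z (splitR hs X))‖ with hb
  rw [summand, dif_pos h]
  -- peel the layers
  have step3 : ∀ (VW : Fin 2 → Γ) (Y : Fin (i - 1) → Γ),
      ‖gInt ε (fun Z : Fin (i - 1) → Γ => (covMatrix (D t) Y Z).det *
          G₁ m₁ r₁ t (argL m₁ i (splitL hs X) Y (VW 0)) * G₂ m₂ r₂ t (argR m₂ i (VW 1) Z (splitR hs X)))‖ ≤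
        ε ^ (i - 1) * (A (i - 1) t * (a Y (VW 0) * ∑ Z, b (VW 1) Z)) := by
    intro VW Y
    refine (norm_gInt_le hε' _).trans (mul_le_mul_of_nonneg_left ?_ (pow_nonneg hε' _))
    rw [Finset.mul_sum, Finset.mul_sum]
    refine Finset.sum_le_sum fun Z _ => ?_
    rw [norm_mul, norm_mul]
    calc ‖(covMatrix (D t) Y Z).det‖ * ‖G₁ m₁ r₁ t (argL m₁ i (splitL hs X) Y (VW 0))‖ *
          ‖G₂ m₂ r₂ t (argR m₂ i (VW 1) Z (splitR hs X))‖
        ≤ A (i - 1) t * ‖G₁ m₁ r₁ t (argL m₁ i (splitL hs X) Y (VW 0))‖ *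
          ‖G₂ m₂ r₂ t (argR m₂ i (VW 1) Z (splitR hs X))‖ := by
            gcongr
            exact hA _ _ _
      _ = A (i - 1) t * (a Y (VW 0) * b (VW 1) Z) := by rw [ha, hb]; ring
  have step2 : ∀ VW : Fin 2 → Γ,
      ‖gInt ε (fun Y : Fin (i - 1) → Γ => gInt ε (fun Z : Fin (i - 1) → Γ =>
          (covMatrix (D t) Y Z).det * G₁ m₁ r₁ t (argL m₁ i (splitL hs X) Y (VW 0)) *
            G₂ m₂ r₂ t (argR m₂ i (VW 1) Z (splitR hs X))))‖ ≤
        ε ^ (i - 1) * (ε ^ (i - 1) * (A (i - 1) t * ((∑ Y, a Y (VW 0)) * ∑ Z, b (VW 1) Z))) := by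
    intro VW
    refine (norm_gInt_le hε' _).trans (mul_le_mul_of_nonneg_left ?_ (pow_nonneg hε' _))
    rw [Finset.sum_mul, Finset.mul_sum, Finset.mul_sum]
    exact Finset.sum_le_sum fun Y _ => step3 VW Y
  have step1 :
      ‖gInt ε (fun VW : Fin 2 → Γ => Ddot t (VW 0) (VW 1) *
          gInt ε (fun Y : Fin (i - 1) → Γ => gInt ε (fun Z : Fin (i - 1) → Γ =>
            (covMatrix (D t) Y Z).det * G₁ m₁ r₁ t (argL m₁ i (splitL hs X) Y (VW 0)) *
              G₂ m₂ r₂ t (argR m₂ i (VW 1) Z (splitR hs X)))))‖ ≤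
        ε ^ 2 * ∑ VW : Fin 2 → Γ, ‖Ddot t (VW 0) (VW 1)‖ *
          (ε ^ (i - 1) * (ε ^ (i - 1) * (A (i - 1) t * ((∑ Y, a Y (VW 0)) * ∑ Z, b (VW 1) Z)))) := by
    refine (norm_gInt_le hε' _).trans (mul_le_mul_of_nonneg_left ?_ (pow_nonneg hε' _))
    refine Finset.sum_le_sum fun VW _ => ?_
    rw [norm_mul]
    exact mul_le_mul_of_nonneg_left (step2 VW) (norm_nonneg _)
  rw [norm_mul, norm_pow, Complex.norm_natCast]
  calc (i : ℝ) ^ 2 * ‖gInt ε (fun VW : Fin 2 → Γ => Ddot t (VW 0) (VW 1) *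
          gInt ε (fun Y : Fin (i - 1) → Γ => gInt ε (fun Z : Fin (i - 1) → Γ =>
            (covMatrix (D t) Y Z).det * G₁ m₁ r₁ t (argL m₁ i (splitL hs X) Y (VW 0)) *
              G₂ m₂ r₂ t (argR m₂ i (VW 1) Z (splitR hs X)))))‖
      ≤ (i : ℝ) ^ 2 * (ε ^ 2 * ∑ VW : Fin 2 → Γ, ‖Ddot t (VW 0) (VW 1)‖ *
          (ε ^ (i - 1) * (ε ^ (i - 1) * (A (i - 1) t * ((∑ Y, a Y (VW 0)) * ∑ Z, b (VW 1) Z))))) :=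
        mul_le_mul_of_nonneg_left step1 (sq_nonneg _)
    _ = (i : ℝ) ^ 2 * A (i - 1) t * (ε ^ 2 * (ε ^ (i - 1) * ε ^ (i - 1))) *
          ∑ VW : Fin 2 → Γ, ‖Ddot t (VW 0) (VW 1)‖ * ((∑ Y, a Y (VW 0)) * ∑ Z, b (VW 1) Z) := by
        rw [Finset.mul_sum, Finset.mul_sum, Finset.mul_sum]
        refine Finset.sum_congr rfl fun VW _ => ?_
        ring

end Summand

/-! ### `φ` and the `Z`-integral of `χ` ((4.10)), and Fubini by injectivity ((4.10)–(4.11)) -/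

section SliceBounds

variable {Γ : Type*} [Fintype Γ]

/-- `φ(V, X₁) = Σ_Y |G_{m₁r₁}(X₁,Y,V)|` of (4.10), unweighted. [cite: Salmhofer1998, (4.10) (p.14 L96–101)] -/
def phiL {m₁ : ℕ} (K₁ : (Fin m₁ → Γ) → ℂ) (i : ℕ) (X₁ : Fin (m₁ - i) → Γ) (V : Γ) : ℝ :=
  ∑ Y : Fin (i - 1) → Γ, ‖K₁ (argL m₁ i X₁ Y V)‖

/-- `Σ_Z |G_{m₂r₂}(W,Z̃,X₂)|`, the `Z`-integral inside `χ(V)` of (4.10), unweighted.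
[cite: Salmhofer1998, (4.10) (p.14 L96–101)] -/
def phiR {m₂ : ℕ} (K₂ : (Fin m₂ → Γ) → ℂ) (i : ℕ) (W : Γ) (X₂ : Fin (m₂ - i) → Γ) : ℝ :=
  ∑ Z : Fin (i - 1) → Γ, ‖K₂ (argR m₂ i W Z X₂)‖

/-- `φ ≥ 0`. [cite: Salmhofer1998, (4.10) (p.14 L96–101)] -/
theorem phiL_nonneg {m₁ : ℕ} (K₁ : (Fin m₁ → Γ) → ℂ) (i : ℕ) (X₁ : Fin (m₁ - i) → Γ) (V : Γ) :
    0 ≤ phiL K₁ i X₁ V :=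
  Finset.sum_nonneg fun _ _ => norm_nonneg _

/-- The `Z`-integral of `χ` is `≥ 0`. [cite: Salmhofer1998, (4.10) (p.14 L96–101)] -/
theorem phiR_nonneg {m₂ : ℕ} (K₂ : (Fin m₂ → Γ) → ℂ) (i : ℕ) (W : Γ) (X₂ : Fin (m₂ - i) → Γ) :
    0 ≤ phiR K₂ i W X₂ :=
  Finset.sum_nonneg fun _ _ => norm_nonneg _

variable [DecidableEq Γ]

/-- `Σ_{V,W} F(V,W)` over `Γ²` written as functions `Fin 2 → Γ` is at most the iterated sum (in fact equal;
`≤` by injectivity of `VW ↦ (VW 0, VW 1)` is all we use). [folklore] -/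
private theorem sum_fin_two_le (G : Γ → Γ → ℝ) (hG : ∀ V W, 0 ≤ G V W) :
    ∑ VW : Fin 2 → Γ, G (VW 0) (VW 1) ≤ ∑ V, ∑ W, G V W := by
  rw [← Finset.sum_product']
  exact sum_comp_le_sum_of_injOn (fun VW : Fin 2 → Γ => (VW 0, VW 1)) (fun q => G q.1 q.2)
    (fun VW _ VW' _ h => by
      have h0 : VW 0 = VW' 0 := congrArg Prod.fst h
      have h1 : VW 1 = VW' 1 := congrArg Prod.snd h
      funext j
      fin_cases j
      · exact h0
      · exact h1)
    (fun VW _ => by simp) (fun q _ => hG q.1 q.2)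

/-- `Σ_W |Ḋ(V,W)| ≤ ε⁻¹ ‖Ḋ‖` (slice of the two-point kernel in its first argument).
[cite: Salmhofer1998, (4.11) (p.14 L105–109)] -/
theorem sum_norm_twoPt_fst_le {ε : ℝ} (hε : 0 < ε) (Dd : Γ → Γ → ℂ) (V : Γ) :
    ∑ W, ‖Dd V W‖ ≤ (ε ^ 1)⁻¹ * kernelNorm ε 2 (twoPt Dd) := by
  have h : ∑ W ∈ (Finset.univ : Finset Γ), ‖twoPt Dd ![V, W]‖ ≤ sliceSum (twoPt Dd) 0 V :=
    sum_comp_le_sum_of_injOn (fun W : Γ => (![V, W] : Fin 2 → Γ)) (fun U => ‖twoPt Dd U‖)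
      (fun W _ W' _ hWW => by simpa using congrFun hWW 1)
      (fun W _ => by simp) (fun U _ => norm_nonneg _)
  calc ∑ W, ‖Dd V W‖ = ∑ W, ‖twoPt Dd ![V, W]‖ := by simp [twoPt]
    _ ≤ sliceSum (twoPt Dd) 0 V := h
    _ ≤ (ε ^ 1)⁻¹ * kernelNorm ε (1 + 1) (twoPt Dd) := sliceSum_le hε _ 0 V

/-- `Σ_V |Ḋ(V,W)| ≤ ε⁻¹ ‖Ḋ‖` (slice of the two-point kernel in its second argument).
[cite: Salmhofer1998, (4.11) (p.14 L105–109)] -/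
theorem sum_norm_twoPt_snd_le {ε : ℝ} (hε : 0 < ε) (Dd : Γ → Γ → ℂ) (W : Γ) :
    ∑ V, ‖Dd V W‖ ≤ (ε ^ 1)⁻¹ * kernelNorm ε 2 (twoPt Dd) := by
  have h : ∑ V ∈ (Finset.univ : Finset Γ), ‖twoPt Dd ![V, W]‖ ≤ sliceSum (twoPt Dd) 1 W :=
    sum_comp_le_sum_of_injOn (fun V : Γ => (![V, W] : Fin 2 → Γ)) (fun U => ‖twoPt Dd U‖)
      (fun V _ V' _ hVV => by simpa using congrFun hVV 0)
      (fun V _ => by simp) (fun U _ => norm_nonneg _)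
  calc ∑ V, ‖Dd V W‖ = ∑ V, ‖twoPt Dd ![V, W]‖ := by simp [twoPt]
    _ ≤ sliceSum (twoPt Dd) 1 W := h
    _ ≤ (ε ^ 1)⁻¹ * kernelNorm ε (1 + 1) (twoPt Dd) := sliceSum_le hε _ 1 W

/-- `sup_V ∫ dX₁ dY |G(X₁,Y,V)| ≤ ε^{-(m₁-1)} ‖G‖`: slice of `G_{m₁r₁}` in its last argument.
[cite: Salmhofer1998, (4.10)–(4.11) (p.14 L96–116)] -/
theorem sum_phiL_le {ε : ℝ} (hε : 0 < ε) {k i : ℕ} (hi : 1 ≤ i) (hik : i ≤ k + 1)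
    (K₁ : (Fin (k + 1) → Γ) → ℂ) (V : Γ) :
    ∑ X₁ : Fin (k + 1 - i) → Γ, phiL K₁ i X₁ V ≤ (ε ^ k)⁻¹ * kernelNorm ε (k + 1) K₁ := by
  unfold phiL
  rw [← Finset.sum_product']
  refine (sum_comp_le_sum_of_injOn
    (s := (Finset.univ : Finset (Fin (k + 1 - i) → Γ)) ×ˢ (Finset.univ : Finset (Fin (i - 1) → Γ)))
    (t := Finset.univ.filter (fun U : Fin (k + 1) → Γ => U ⟨k + 1 - 1, by omega⟩ = V))
    (fun q : (Fin (k + 1 - i) → Γ) × (Fin (i - 1) → Γ) => argL (k + 1) i q.1 q.2 V) (fun U => ‖K₁ U‖)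
    ?_ ?_ ?_).trans (sliceSum_le hε K₁ ⟨k + 1 - 1, by omega⟩ V)
  · intro q _ q' _ hqq
    obtain ⟨h1, h2, -⟩ := argL_injective hi hik hqq
    exact Prod.ext h1 h2
  · intro q _
    simp only [Finset.mem_filter, Finset.mem_univ, true_and]
    exact argL_apply_last hi hik q.1 q.2 V
  · intro U _
    exact norm_nonneg _

/-- `sup_W ∫ dZ dX₂ |G(W,Z̃,X₂)| ≤ ε^{-(m₂-1)} ‖G‖`: slice of `G_{m₂r₂}` in its first argument.
[cite: Salmhofer1998, (4.11) (p.14 L105–116)] -/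
theorem sum_phiR_le {ε : ℝ} (hε : 0 < ε) {l i : ℕ} (hi : 1 ≤ i) (hil : i ≤ l + 1)
    (K₂ : (Fin (l + 1) → Γ) → ℂ) (W : Γ) :
    ∑ X₂ : Fin (l + 1 - i) → Γ, phiR K₂ i W X₂ ≤ (ε ^ l)⁻¹ * kernelNorm ε (l + 1) K₂ := by
  unfold phiR
  rw [← Finset.sum_product']
  refine (sum_comp_le_sum_of_injOn
    (s := (Finset.univ : Finset (Fin (l + 1 - i) → Γ)) ×ˢ (Finset.univ : Finset (Fin (i - 1) → Γ)))
    (t := Finset.univ.filter (fun U : Fin (l + 1) → Γ => U ⟨0, by omega⟩ = W))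
    (fun q : (Fin (l + 1 - i) → Γ) × (Fin (i - 1) → Γ) => argR (l + 1) i W q.2 q.1) (fun U => ‖K₂ U‖)
    ?_ ?_ ?_).trans (sliceSum_le hε K₂ ⟨0, by omega⟩ W)
  · intro q _ q' _ hqq
    obtain ⟨-, h2, h1⟩ := argR_injective hi hil hqq
    exact Prod.ext h1 h2
  · intro q _
    simp only [Finset.mem_filter, Finset.mem_univ, true_and]
    exact argR_apply_zero (i := i) (by omega) W q.2 q.1
  · intro U _
    exact norm_nonneg _

/-- `∫ dX₁ dV φ(V, X₁)` restricted to `X_p = x` (`p` a leg of `X₁`) is `≤ ε^{-(m₁-1)} ‖G_{m₁r₁}‖`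
((4.10): "can be done independently of the rest and gives `|G_{m₁r₁}(t)|`").
[cite: Salmhofer1998, (4.10)–(4.11) (p.14 L96–116)] -/
theorem sum_filter_phiL_le {ε : ℝ} (hε : 0 < ε) {k i : ℕ} (hi : 1 ≤ i) (hik : i ≤ k + 1)
    (K₁ : (Fin (k + 1) → Γ) → ℂ) (q₀ : Fin (k + 1 - i)) (x : Γ) :
    ∑ X₁ ∈ Finset.univ.filter (fun X₁ : Fin (k + 1 - i) → Γ => X₁ q₀ = x), ∑ V, phiL K₁ i X₁ V ≤
      (ε ^ k)⁻¹ * kernelNorm ε (k + 1) K₁ := by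
  unfold phiL
  rw [← Finset.sum_product', ← Finset.sum_product']
  refine (sum_comp_le_sum_of_injOn
    (s := (Finset.univ.filter (fun X₁ : Fin (k + 1 - i) → Γ => X₁ q₀ = x) ×ˢ (Finset.univ : Finset Γ)) ×ˢ
      (Finset.univ : Finset (Fin (i - 1) → Γ)))
    (t := Finset.univ.filter (fun U : Fin (k + 1) → Γ => U ⟨q₀.val, by have := q₀.isLt; omega⟩ = x))
    (fun q : ((Fin (k + 1 - i) → Γ) × Γ) × (Fin (i - 1) → Γ) => argL (k + 1) i q.1.1 q.2 q.1.2)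
    (fun U => ‖K₁ U‖) ?_ ?_ ?_).trans (sliceSum_le hε K₁ ⟨q₀.val, by have := q₀.isLt; omega⟩ x)
  · intro q _ q' _ hqq
    obtain ⟨h1, h2, h3⟩ := argL_injective hi hik hqq
    exact Prod.ext (Prod.ext h1 h3) h2
  · intro q hq
    simp only [Finset.mem_product, Finset.mem_filter, Finset.mem_univ, true_and, and_true] at hq ⊢
    rw [argL_apply_lt]
    exact hq
  · intro U _
    exact norm_nonneg _

/-- The mirror case: `∫ dX₂ dW dZ |G(W,Z̃,X₂)|` restricted to `X_p = x` (`p` a leg of `X₂`) is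
`≤ ε^{-(m₂-1)} ‖G_{m₂r₂}‖` ("the other case is similar", p.14 L93–94).
[cite: Salmhofer1998, (4.10)–(4.11) (p.14 L91–116)] -/
theorem sum_filter_phiR_le {ε : ℝ} (hε : 0 < ε) {l i : ℕ} (hi : 1 ≤ i) (hil : i ≤ l + 1)
    (K₂ : (Fin (l + 1) → Γ) → ℂ) (q₀ : Fin (l + 1 - i)) (x : Γ) :
    ∑ X₂ ∈ Finset.univ.filter (fun X₂ : Fin (l + 1 - i) → Γ => X₂ q₀ = x), ∑ W, phiR K₂ i W X₂ ≤
      (ε ^ l)⁻¹ * kernelNorm ε (l + 1) K₂ := by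
  unfold phiR
  rw [← Finset.sum_product', ← Finset.sum_product']
  refine (sum_comp_le_sum_of_injOn
    (s := (Finset.univ.filter (fun X₂ : Fin (l + 1 - i) → Γ => X₂ q₀ = x) ×ˢ (Finset.univ : Finset Γ)) ×ˢ
      (Finset.univ : Finset (Fin (i - 1) → Γ)))
    (t := Finset.univ.filter (fun U : Fin (l + 1) → Γ => U ⟨i + q₀.val, by have := q₀.isLt; omega⟩ = x))
    (fun q : ((Fin (l + 1 - i) → Γ) × Γ) × (Fin (i - 1) → Γ) => argR (l + 1) i q.1.2 q.2 q.1.1)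
    (fun U => ‖K₂ U‖) ?_ ?_ ?_).trans (sliceSum_le hε K₂ ⟨i + q₀.val, by have := q₀.isLt; omega⟩ x)
  · intro q _ q' _ hqq
    obtain ⟨h1, h2, h3⟩ := argR_injective hi hil hqq
    exact Prod.ext (Prod.ext h3 h1) h2
  · intro q hq
    simp only [Finset.mem_product, Finset.mem_filter, Finset.mem_univ, true_and, and_true] at hq ⊢
    rw [argR_apply_ge hi hil]
    exact hq
  · intro U _
    exact norm_nonneg _

/-- Case `p ≤ m₁ - i` of the proof of Lemma 1 (`X_p` is a component of `X₁`), lines (4.10)–(4.11):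
the slice of the `(V,W,Y,Z)`-integrated absolute values is bounded by
`ε^{-(m₂-1)}‖G₂‖ · ε^{-1}‖Ḋ‖ · ε^{-(m₁-1)}‖G₁‖`. [cite: Salmhofer1998, Lemma 1 proof (p.14 L91–116)] -/
theorem sliceCore_le_left {ε : ℝ} (hε : 0 < ε) {k l i n : ℕ} (hi : 1 ≤ i) (hik : i ≤ k + 1)
    (hil : i ≤ l + 1) (hs : (k + 1 - i) + (l + 1 - i) = n + 1)
    (K₁ : (Fin (k + 1) → Γ) → ℂ) (K₂ : (Fin (l + 1) → Γ) → ℂ) (Dd : Γ → Γ → ℂ)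
    (p : Fin (n + 1)) (x : Γ) (hp : p.val < k + 1 - i) :
    ∑ X ∈ Finset.univ.filter (fun X : Fin (n + 1) → Γ => X p = x),
        ∑ VW : Fin 2 → Γ, ‖Dd (VW 0) (VW 1)‖ *
          (phiL K₁ i (splitL hs X) (VW 0) * phiR K₂ i (VW 1) (splitR hs X)) ≤
      ((ε ^ l)⁻¹ * kernelNorm ε (l + 1) K₂) * ((ε ^ 1)⁻¹ * kernelNorm ε 2 (twoPt Dd)) *
        ((ε ^ k)⁻¹ * kernelNorm ε (k + 1) K₁) := by
  set CB := (ε ^ l)⁻¹ * kernelNorm ε (l + 1) K₂ with hCB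
  set CD := (ε ^ 1)⁻¹ * kernelNorm ε 2 (twoPt Dd) with hCD
  set CA := (ε ^ k)⁻¹ * kernelNorm ε (k + 1) K₁ with hCA
  have hCB0 : 0 ≤ CB := mul_nonneg (inv_nonneg.mpr (pow_nonneg hε.le _)) (kernelNorm_nonneg hε.le _ _)
  have hCD0 : 0 ≤ CD := mul_nonneg (inv_nonneg.mpr (pow_nonneg hε.le _)) (kernelNorm_nonneg hε.le _ _)
  have hd0 : ∀ V W, 0 ≤ ‖Dd V W‖ := fun _ _ => norm_nonneg _
  let q₀ : Fin (k + 1 - i) := ⟨p.val, hp⟩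
  let S₁ := Finset.univ.filter (fun X₁ : Fin (k + 1 - i) → Γ => X₁ q₀ = x)
  -- (a) the substitution `X ↦ (X₁, X₂)` (injective), `X_p` a component of `X₁`
  have stepA : ∑ X ∈ Finset.univ.filter (fun X : Fin (n + 1) → Γ => X p = x),
        ∑ VW : Fin 2 → Γ, ‖Dd (VW 0) (VW 1)‖ *
          (phiL K₁ i (splitL hs X) (VW 0) * phiR K₂ i (VW 1) (splitR hs X)) ≤
      ∑ q ∈ S₁ ×ˢ (Finset.univ : Finset (Fin (l + 1 - i) → Γ)),
        ∑ VW : Fin 2 → Γ, ‖Dd (VW 0) (VW 1)‖ * (phiL K₁ i q.1 (VW 0) * phiR K₂ i (VW 1) q.2) :=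
    sum_comp_le_sum_of_injOn (fun X => (splitL hs X, splitR hs X))
      (fun q => ∑ VW : Fin 2 → Γ, ‖Dd (VW 0) (VW 1)‖ * (phiL K₁ i q.1 (VW 0) * phiR K₂ i (VW 1) q.2))
      (fun X _ X' _ hXX => split_injective hs (congrArg Prod.fst hXX) (congrArg Prod.snd hXX))
      (fun X hX => by
        simp only [Finset.mem_filter, Finset.mem_univ, true_and] at hX
        simp only [S₁, q₀, Finset.mem_product, Finset.mem_filter, Finset.mem_univ, true_and, and_true,
          splitL, Fin.eta]
        exact hX)
      (fun q _ => Finset.sum_nonneg fun VW _ =>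
        mul_nonneg (norm_nonneg _) (mul_nonneg (phiL_nonneg _ _ _ _) (phiR_nonneg _ _ _ _)))
  -- (b) Fubini: the `X₂`-integration moves inside
  have stepB : ∑ q ∈ S₁ ×ˢ (Finset.univ : Finset (Fin (l + 1 - i) → Γ)),
        ∑ VW : Fin 2 → Γ, ‖Dd (VW 0) (VW 1)‖ * (phiL K₁ i q.1 (VW 0) * phiR K₂ i (VW 1) q.2) =
      ∑ X₁ ∈ S₁, ∑ VW : Fin 2 → Γ, ‖Dd (VW 0) (VW 1)‖ *
        (phiL K₁ i X₁ (VW 0) * ∑ X₂ : Fin (l + 1 - i) → Γ, phiR K₂ i (VW 1) X₂) := by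
    rw [Finset.sum_product]
    refine Finset.sum_congr rfl fun X₁ _ => ?_
    dsimp only
    rw [Finset.sum_comm]
    refine Finset.sum_congr rfl fun VW _ => ?_
    rw [Finset.mul_sum, Finset.mul_sum]
  -- (c) the bounds (4.11)
  calc ∑ X ∈ Finset.univ.filter (fun X : Fin (n + 1) → Γ => X p = x),
        ∑ VW : Fin 2 → Γ, ‖Dd (VW 0) (VW 1)‖ *
          (phiL K₁ i (splitL hs X) (VW 0) * phiR K₂ i (VW 1) (splitR hs X))
      ≤ ∑ X₁ ∈ S₁, ∑ VW : Fin 2 → Γ, ‖Dd (VW 0) (VW 1)‖ *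
          (phiL K₁ i X₁ (VW 0) * ∑ X₂ : Fin (l + 1 - i) → Γ, phiR K₂ i (VW 1) X₂) :=
        stepA.trans stepB.le
    _ ≤ ∑ X₁ ∈ S₁, ∑ VW : Fin 2 → Γ, ‖Dd (VW 0) (VW 1)‖ * (phiL K₁ i X₁ (VW 0) * CB) :=
        Finset.sum_le_sum fun X₁ _ => Finset.sum_le_sum fun VW _ =>
          mul_le_mul_of_nonneg_left
            (mul_le_mul_of_nonneg_left (sum_phiR_le hε hi hil K₂ (VW 1)) (phiL_nonneg _ _ _ _))
            (hd0 _ _)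
    _ ≤ ∑ X₁ ∈ S₁, ∑ V, ∑ W, ‖Dd V W‖ * (phiL K₁ i X₁ V * CB) :=
        Finset.sum_le_sum fun X₁ _ =>
          sum_fin_two_le (fun V W => ‖Dd V W‖ * (phiL K₁ i X₁ V * CB)) fun V W =>
            mul_nonneg (hd0 V W) (mul_nonneg (phiL_nonneg _ _ _ _) hCB0)
    _ = ∑ X₁ ∈ S₁, ∑ V, (CB * phiL K₁ i X₁ V) * ∑ W, ‖Dd V W‖ := by
        refine Finset.sum_congr rfl fun X₁ _ => Finset.sum_congr rfl fun V _ => ?_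
        rw [Finset.mul_sum]
        exact Finset.sum_congr rfl fun W _ => by ring
    _ ≤ ∑ X₁ ∈ S₁, ∑ V, (CB * phiL K₁ i X₁ V) * CD :=
        Finset.sum_le_sum fun X₁ _ => Finset.sum_le_sum fun V _ =>
          mul_le_mul_of_nonneg_left (sum_norm_twoPt_fst_le hε Dd V)
            (mul_nonneg hCB0 (phiL_nonneg _ _ _ _))
    _ = (CB * CD) * ∑ X₁ ∈ S₁, ∑ V, phiL K₁ i X₁ V := by
        rw [Finset.mul_sum]
        refine Finset.sum_congr rfl fun X₁ _ => ?_
        rw [Finset.mul_sum]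
        exact Finset.sum_congr rfl fun V _ => by ring
    _ ≤ (CB * CD) * CA :=
        mul_le_mul_of_nonneg_left (sum_filter_phiL_le hε hi hik K₁ q₀ x) (mul_nonneg hCB0 hCD0)
    _ = CB * CD * CA := rfl

/-- Case `p > m₁ - i` of the proof of Lemma 1 (`X_p` is a component of `X₂`; "the other case is similar
by the symmetry of the sum for `Q_{m,r}` in `m₁` and `m₂`", p.14 L93–94): same bound.
[cite: Salmhofer1998, Lemma 1 proof (p.14 L91–116)] -/
theorem sliceCore_le_right {ε : ℝ} (hε : 0 < ε) {k l i n : ℕ} (hi : 1 ≤ i) (hik : i ≤ k + 1)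
    (hil : i ≤ l + 1) (hs : (k + 1 - i) + (l + 1 - i) = n + 1)
    (K₁ : (Fin (k + 1) → Γ) → ℂ) (K₂ : (Fin (l + 1) → Γ) → ℂ) (Dd : Γ → Γ → ℂ)
    (p : Fin (n + 1)) (x : Γ) (hp : ¬ p.val < k + 1 - i) :
    ∑ X ∈ Finset.univ.filter (fun X : Fin (n + 1) → Γ => X p = x),
        ∑ VW : Fin 2 → Γ, ‖Dd (VW 0) (VW 1)‖ *
          (phiL K₁ i (splitL hs X) (VW 0) * phiR K₂ i (VW 1) (splitR hs X)) ≤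
      ((ε ^ l)⁻¹ * kernelNorm ε (l + 1) K₂) * ((ε ^ 1)⁻¹ * kernelNorm ε 2 (twoPt Dd)) *
        ((ε ^ k)⁻¹ * kernelNorm ε (k + 1) K₁) := by
  set CB := (ε ^ l)⁻¹ * kernelNorm ε (l + 1) K₂ with hCB
  set CD := (ε ^ 1)⁻¹ * kernelNorm ε 2 (twoPt Dd) with hCD
  set CA := (ε ^ k)⁻¹ * kernelNorm ε (k + 1) K₁ with hCA
  have hCA0 : 0 ≤ CA := mul_nonneg (inv_nonneg.mpr (pow_nonneg hε.le _)) (kernelNorm_nonneg hε.le _ _)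
  have hCD0 : 0 ≤ CD := mul_nonneg (inv_nonneg.mpr (pow_nonneg hε.le _)) (kernelNorm_nonneg hε.le _ _)
  have hd0 : ∀ V W, 0 ≤ ‖Dd V W‖ := fun _ _ => norm_nonneg _
  have hp' : p.val - (k + 1 - i) < l + 1 - i := by have := p.isLt; omega
  let q₀ : Fin (l + 1 - i) := ⟨p.val - (k + 1 - i), hp'⟩
  let S₂ := Finset.univ.filter (fun X₂ : Fin (l + 1 - i) → Γ => X₂ q₀ = x)
  -- (a) the substitution `X ↦ (X₁, X₂)` (injective), `X_p` a component of `X₂`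
  have stepA : ∑ X ∈ Finset.univ.filter (fun X : Fin (n + 1) → Γ => X p = x),
        ∑ VW : Fin 2 → Γ, ‖Dd (VW 0) (VW 1)‖ *
          (phiL K₁ i (splitL hs X) (VW 0) * phiR K₂ i (VW 1) (splitR hs X)) ≤
      ∑ q ∈ (Finset.univ : Finset (Fin (k + 1 - i) → Γ)) ×ˢ S₂,
        ∑ VW : Fin 2 → Γ, ‖Dd (VW 0) (VW 1)‖ * (phiL K₁ i q.1 (VW 0) * phiR K₂ i (VW 1) q.2) :=
    sum_comp_le_sum_of_injOn (fun X => (splitL hs X, splitR hs X))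
      (fun q => ∑ VW : Fin 2 → Γ, ‖Dd (VW 0) (VW 1)‖ * (phiL K₁ i q.1 (VW 0) * phiR K₂ i (VW 1) q.2))
      (fun X _ X' _ hXX => split_injective hs (congrArg Prod.fst hXX) (congrArg Prod.snd hXX))
      (fun X hX => by
        simp only [Finset.mem_filter, Finset.mem_univ, true_and] at hX
        simp only [S₂, q₀, Finset.mem_product, Finset.mem_filter, Finset.mem_univ, true_and,
          splitR]
        have e : (⟨(k + 1 - i) + (p.val - (k + 1 - i)), by omega⟩ : Fin (n + 1)) = p := by
          ext; simp only; omega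
        rw [e]
        exact hX)
      (fun q _ => Finset.sum_nonneg fun VW _ =>
        mul_nonneg (norm_nonneg _) (mul_nonneg (phiL_nonneg _ _ _ _) (phiR_nonneg _ _ _ _)))
  -- (b) Fubini: the `X₁`-integration moves inside
  have stepB : ∑ q ∈ (Finset.univ : Finset (Fin (k + 1 - i) → Γ)) ×ˢ S₂,
        ∑ VW : Fin 2 → Γ, ‖Dd (VW 0) (VW 1)‖ * (phiL K₁ i q.1 (VW 0) * phiR K₂ i (VW 1) q.2) =
      ∑ X₂ ∈ S₂, ∑ VW : Fin 2 → Γ, ‖Dd (VW 0) (VW 1)‖ *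
        ((∑ X₁ : Fin (k + 1 - i) → Γ, phiL K₁ i X₁ (VW 0)) * phiR K₂ i (VW 1) X₂) := by
    rw [Finset.sum_product, Finset.sum_comm]
    refine Finset.sum_congr rfl fun X₂ _ => ?_
    dsimp only
    rw [Finset.sum_comm]
    refine Finset.sum_congr rfl fun VW _ => ?_
    rw [Finset.sum_mul, Finset.mul_sum]
  -- (c) the bounds (4.11), mirrored
  calc ∑ X ∈ Finset.univ.filter (fun X : Fin (n + 1) → Γ => X p = x),
        ∑ VW : Fin 2 → Γ, ‖Dd (VW 0) (VW 1)‖ *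
          (phiL K₁ i (splitL hs X) (VW 0) * phiR K₂ i (VW 1) (splitR hs X))
      ≤ ∑ X₂ ∈ S₂, ∑ VW : Fin 2 → Γ, ‖Dd (VW 0) (VW 1)‖ *
          ((∑ X₁ : Fin (k + 1 - i) → Γ, phiL K₁ i X₁ (VW 0)) * phiR K₂ i (VW 1) X₂) :=
        stepA.trans stepB.le
    _ ≤ ∑ X₂ ∈ S₂, ∑ VW : Fin 2 → Γ, ‖Dd (VW 0) (VW 1)‖ * (CA * phiR K₂ i (VW 1) X₂) :=
        Finset.sum_le_sum fun X₂ _ => Finset.sum_le_sum fun VW _ =>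
          mul_le_mul_of_nonneg_left
            (mul_le_mul_of_nonneg_right (sum_phiL_le hε hi hik K₁ (VW 0)) (phiR_nonneg _ _ _ _))
            (hd0 _ _)
    _ ≤ ∑ X₂ ∈ S₂, ∑ V, ∑ W, ‖Dd V W‖ * (CA * phiR K₂ i W X₂) :=
        Finset.sum_le_sum fun X₂ _ =>
          sum_fin_two_le (fun V W => ‖Dd V W‖ * (CA * phiR K₂ i W X₂)) fun V W =>
            mul_nonneg (hd0 V W) (mul_nonneg hCA0 (phiR_nonneg _ _ _ _))
    _ = ∑ X₂ ∈ S₂, ∑ W, (CA * phiR K₂ i W X₂) * ∑ V, ‖Dd V W‖ := by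
        refine Finset.sum_congr rfl fun X₂ _ => ?_
        rw [Finset.sum_comm]
        refine Finset.sum_congr rfl fun W _ => ?_
        rw [Finset.mul_sum]
        exact Finset.sum_congr rfl fun V _ => by ring
    _ ≤ ∑ X₂ ∈ S₂, ∑ W, (CA * phiR K₂ i W X₂) * CD :=
        Finset.sum_le_sum fun X₂ _ => Finset.sum_le_sum fun W _ =>
          mul_le_mul_of_nonneg_left (sum_norm_twoPt_snd_le hε Dd W)
            (mul_nonneg hCA0 (phiR_nonneg _ _ _ _))
    _ = (CA * CD) * ∑ X₂ ∈ S₂, ∑ W, phiR K₂ i W X₂ := by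
        rw [Finset.mul_sum]
        refine Finset.sum_congr rfl fun X₂ _ => ?_
        rw [Finset.mul_sum]
        exact Finset.sum_congr rfl fun W _ => by ring
    _ ≤ (CA * CD) * CB :=
        mul_le_mul_of_nonneg_left (sum_filter_phiR_le hε hi hil K₂ q₀ x) (mul_nonneg hCA0 hCD0)
    _ = CB * CD * CA := by ring

end SliceBounds

/-! ### Assembly: the bound per index, and Lemma 1 -/

section Assembly

variable {Γ : Type*} [Fintype Γ] [DecidableEq Γ]

/-- The bound per index `(r₁,m₁,r₂,m₂,i) ∈ 𝓜` with `κ_{m₁m₂i} ≠ 0`: the weighted slice of the summand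
of (4.3) is `≤ i² A_{i-1}(t) ‖Ḋ_t‖ ‖G_{m₁r₁}(t)‖ ‖G_{m₂r₂}(t)‖` (both cases of `p`; the powers of `ε`
cancel because `m₁ + m₂ = m + 2i`). [cite: Salmhofer1998, Lemma 1 proof (p.14 L78–116)] -/
theorem mul_sliceSum_summand_le {ε : ℝ} (hε : 0 < ε) {D Ddot : ℝ → Γ → Γ → ℂ} {G₁ G₂ : KernelFamily Γ}
    {A : ℕ → ℝ → ℝ} {t : ℝ}
    (hA : ∀ (i : ℕ) (Y Z : Fin i → Γ), ‖(covMatrix (D t) Y Z).det‖ ≤ A i t)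
    {n : ℕ} (r₁ m₁ r₂ m₂ i : ℕ) (hi : 1 ≤ i) (hi₁ : i ≤ m₁) (hi₂ : i ≤ m₂)
    (hm : m₁ + m₂ = (n + 1) + 2 * i) (p : Fin (n + 1)) (x : Γ) :
    ε ^ n * sliceSum (summand ε D Ddot G₁ G₂ t r₁ m₁ r₂ m₂ i (n + 1)) p x ≤
      (i : ℝ) ^ 2 * A (i - 1) t * kernelNorm ε 2 (twoPt (Ddot t)) * kernelNorm ε m₁ (G₁ m₁ r₁ t) *
        kernelNorm ε m₂ (G₂ m₂ r₂ t) := by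
  obtain ⟨k, rfl⟩ : ∃ k, m₁ = k + 1 := ⟨m₁ - 1, by omega⟩
  obtain ⟨l, rfl⟩ : ∃ l, m₂ = l + 1 := ⟨m₂ - 1, by omega⟩
  have hs : (k + 1 - i) + (l + 1 - i) = n + 1 := by omega
  have h : i ≤ k + 1 ∧ i ≤ l + 1 ∧ (k + 1) + (l + 1) = (n + 1) + 2 * i := ⟨hi₁, hi₂, hm⟩
  have hA0 : 0 ≤ A (i - 1) t := (norm_nonneg _).trans (hA (i - 1) (fun _ => x) (fun _ => x))
  set C := (i : ℝ) ^ 2 * A (i - 1) t * (ε ^ 2 * (ε ^ (i - 1) * ε ^ (i - 1))) with hC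
  have hC0 : 0 ≤ C := mul_nonneg (mul_nonneg (sq_nonneg _) hA0) (by positivity)
  set CB := (ε ^ l)⁻¹ * kernelNorm ε (l + 1) (G₂ (l + 1) r₂ t) with hCB
  set CD := (ε ^ 1)⁻¹ * kernelNorm ε 2 (twoPt (Ddot t)) with hCD
  set CA := (ε ^ k)⁻¹ * kernelNorm ε (k + 1) (G₁ (k + 1) r₁ t) with hCA
  -- the core sum and its bound in both cases
  have hT : ∑ X ∈ Finset.univ.filter (fun X : Fin (n + 1) → Γ => X p = x),
        ∑ VW : Fin 2 → Γ, ‖Ddot t (VW 0) (VW 1)‖ *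
          (phiL (G₁ (k + 1) r₁ t) i (splitL hs X) (VW 0) *
            phiR (G₂ (l + 1) r₂ t) i (VW 1) (splitR hs X)) ≤ CB * CD * CA := by
    by_cases hp : p.val < k + 1 - i
    · exact sliceCore_le_left hε hi hi₁ hi₂ hs _ _ _ p x hp
    · exact sliceCore_le_right hε hi hi₁ hi₂ hs _ _ _ p x hp
  -- the powers of ε cancel
  have key : ε ^ n * (ε ^ 2 * (ε ^ (i - 1) * ε ^ (i - 1))) = ε ^ l * (ε ^ 1 * ε ^ k) := by
    simp only [← pow_add]
    congr 1
    omega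
  have hl : (ε ^ l) ≠ 0 := pow_ne_zero _ hε.ne'
  have h1 : (ε ^ 1) ≠ 0 := pow_ne_zero _ hε.ne'
  have hk : (ε ^ k) ≠ 0 := pow_ne_zero _ hε.ne'
  unfold sliceSum
  calc ε ^ n * ∑ X ∈ Finset.univ.filter (fun X : Fin (n + 1) → Γ => X p = x),
          ‖summand ε D Ddot G₁ G₂ t r₁ (k + 1) r₂ (l + 1) i (n + 1) X‖
      ≤ ε ^ n * ∑ X ∈ Finset.univ.filter (fun X : Fin (n + 1) → Γ => X p = x),
          C * ∑ VW : Fin 2 → Γ, ‖Ddot t (VW 0) (VW 1)‖ *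
            (phiL (G₁ (k + 1) r₁ t) i (splitL hs X) (VW 0) *
              phiR (G₂ (l + 1) r₂ t) i (VW 1) (splitR hs X)) :=
        mul_le_mul_of_nonneg_left
          (Finset.sum_le_sum fun X _ => norm_summand_le hε hA r₁ (k + 1) r₂ (l + 1) i (n + 1) h X)
          (pow_nonneg hε.le n)
    _ = ε ^ n * C * ∑ X ∈ Finset.univ.filter (fun X : Fin (n + 1) → Γ => X p = x),
          ∑ VW : Fin 2 → Γ, ‖Ddot t (VW 0) (VW 1)‖ *
            (phiL (G₁ (k + 1) r₁ t) i (splitL hs X) (VW 0) *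
              phiR (G₂ (l + 1) r₂ t) i (VW 1) (splitR hs X)) := by
        rw [← Finset.mul_sum]
        ring
    _ ≤ ε ^ n * C * (CB * CD * CA) :=
        mul_le_mul_of_nonneg_left hT (mul_nonneg (pow_nonneg hε.le n) hC0)
    _ = (ε ^ n * (ε ^ 2 * (ε ^ (i - 1) * ε ^ (i - 1)))) * ((ε ^ l)⁻¹ * ((ε ^ 1)⁻¹ * (ε ^ k)⁻¹)) *
          ((i : ℝ) ^ 2 * A (i - 1) t * kernelNorm ε 2 (twoPt (Ddot t)) *
            kernelNorm ε (k + 1) (G₁ (k + 1) r₁ t) * kernelNorm ε (l + 1) (G₂ (l + 1) r₂ t)) := by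
        rw [hC, hCB, hCD, hCA]; ring
    _ = (i : ℝ) ^ 2 * A (i - 1) t * kernelNorm ε 2 (twoPt (Ddot t)) *
          kernelNorm ε (k + 1) (G₁ (k + 1) r₁ t) * kernelNorm ε (l + 1) (G₂ (l + 1) r₂ t) := by
        rw [key]
        field_simp

/-- **Salmhofer 1998, Lemma 1** (the `L¹–L^∞` bound (4.5)), discharging the named fact
`DeterminantNormBound` (licence F-079): if `|det 𝒟_t^{(i)}(Y,Z)| ≤ A_i(t)` for all `i, Y, Z`, then
`|Q_{mr}(t)| ≤ ∫ dκ_{mr} i² A_{i-1}(t) |Ḋ_t| |G_{m₁r₁}(t)| |G_{m₂r₂}(t)|` for every `m ≥ 1`, `r`.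
[cite: Salmhofer1998, Lemma 1 (p.14 L63–76; proof L78–116)] -/
theorem DeterminantNormBound_holds : DeterminantNormBound := by
  intro Γ _ _ ε hε mbar D Ddot G₁ G₂ A t hA m r hm
  obtain ⟨n, rfl⟩ : ∃ n, m = n + 1 := ⟨m - 1, by omega⟩
  unfold sNorm
  rcases isEmpty_or_nonempty Γ with hΓ | hΓ
  · -- no points: the left side is `0`, every term on the right has the factor `‖G_{m₁r₁}‖ = 0`
    rw [kernelNorm_of_isEmpty, re_kappaSum_ofReal]
    refine Finset.sum_nonneg fun r₁ _ => Finset.sum_nonneg fun m₁ hm₁ =>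
      Finset.sum_nonneg fun m₂ _ => Finset.sum_nonneg fun i _ => ?_
    obtain ⟨k, rfl⟩ : ∃ k, m₁ = k + 1 := ⟨m₁ - 1, by have := (Finset.mem_Icc.mp hm₁).1; omega⟩
    simp [kernelNorm_of_isEmpty]
  · refine kernelNorm_le_of_sliceSum_le ε _ fun p x => ?_
    have main := mul_sliceSum_kappaSum_le (Γ := Γ) mbar (n + 1) r
      (fun r₁ m₁ r₂ m₂ i X => summand ε D Ddot G₁ G₂ t r₁ m₁ r₂ m₂ i (n + 1) X)
      (fun r₁ m₁ r₂ m₂ i => (i : ℝ) ^ 2 * A (i - 1) t * kernelNorm ε 2 (twoPt (Ddot t)) *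
        kernelNorm ε m₁ (G₁ m₁ r₁ t) * kernelNorm ε m₂ (G₂ m₂ r₂ t))
      (pow_nonneg hε.le n) p x
      (fun r₁ m₁ m₂ i hi hi₁ hi₂ hsum =>
        mul_sliceSum_summand_le hε hA r₁ m₁ (r - r₁) m₂ i hi hi₁ hi₂ hsum p x)
    exact main

end Assembly

end Salmhofer1998

end Literature.MathematicalPhysics.QuantumLattice.FermiRG
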